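import Mathlib.Topology.Algebra.Group.Basic
import Mathlib.Topology.Algebra.Group.Pointwise
import HarnessLib

/-!
# Compact-coset depth: `⋂ᵢ A · Kᵢ · C = A · (⋂ᵢ Kᵢ) · C` for compact `A`, `C` and a directed closed family `(Kᵢ)`

Topic `Topology/Algebra`, namespace `Literature.Topology.Algebra`.  THEOREMS ONLY (no definition, no named fact, no
instance, no `sorry`); Mathlib-only imports.  Siblings in this directory: `CompactMulInterAntitone` (the ONE-SIDED identity
`⋂ᵢ C · Uᵢ = C · ⋂ᵢ Uᵢ` for an antitone family over a directed preorder, by cluster points — not restated here) and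
`CompactOpenSubgroupTrace` (the «trace» half of the small-level injectivity argument for embeddings of Shimura varieties).

Let `G` be a topological group, `A, C ⊆ G` COMPACT subsets and `K : ι → Set G` (`ι` nonempty) a DIRECTED family of
CLOSED subsets (`Directed (· ⊇ ·) K`: any two members contain a common third; no order on `ι` is needed).  Then

* `exists_not_mem_mul_mul_of_not_mem` (DEPTH, the core): every `x ∉ A · (⋂ᵢ Kᵢ) · C` already lies outside `A · Kᵢ · C`
  for SOME single index `i`;
* `iInter_mul_mul_eq_mul_iInter_mul`: `⋂ᵢ A · Kᵢ · C = A · (⋂ᵢ Kᵢ) · C` (TWO-SIDED: compact factors on both sides), and its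
  one-sided mirror `iInter_mul_eq_iInter_mul : ⋂ᵢ Kᵢ · C = (⋂ᵢ Kᵢ) · C`;
* when `⋂ᵢ Kᵢ ⊆ {1}` (shrinking levels): `exists_not_mem_mul_mul` (`x ∉ A · C ⇒ ∃ i, x ∉ A · Kᵢ · C`),
  `exists_forall_not_mem_mul_mul_of_finite` (a FINITE set disjoint from `A · C` is disjoint from `A · Kᵢ · C` for ONE `i`)
  and, if also `1 ∈ Kᵢ`, `iInter_mul_mul_eq : ⋂ᵢ A · Kᵢ · C = A · C`;
* `Subgroup` wrappers for a directed family of closed subgroups with trivial intersection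
  (`∀ x, (∀ i, x ∈ Kᵢ) → x = 1`): `exists_forall_not_mem_mul_coe_mul_of_finite`, `iInter_mul_coe_mul_eq`, and the
  «eventually» form `exists_forall_ge_forall_not_mem_mul_coe_mul_of_finite` (`∃ i, ∀ j ≥ i, …`) for an ANTITONE family
  on a directed preorder.

NO separation axiom and NO total disconnectedness is assumed, and `ι` carries no order: the proof is the
finite-intersection property of the compact set `A ×ˢ C ⊆ G × G` against the directed closed family
`tᵢ := {(a, c) | a⁻¹ · x · c⁻¹ ∈ Kᵢ}` (Mathlib `IsCompact.elim_directed_family_closed`): a point of `A ×ˢ C` common to all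
`tᵢ` is exactly a factorisation `x = a · k · c` with `k ∈ ⋂ᵢ Kᵢ`.

USE (arithmetic quotients).  With `G = 𝐆(𝔸_f)`, `Kᵢ = K(𝔫)` the principal congruence subgroups (compact open,
`⋂_𝔫 K(𝔫) = 1`) and compact cosets `A = g K⋆`, `C = K⋆ g'⁻¹`, the finite-set form says that finitely many rational elements
`q ∉ g K⋆ · K⋆ g'⁻¹` responsible for unwanted coincidences lie outside `g K⋆ · K(𝔫) · K⋆ g'⁻¹` at one common DEPTH `𝔫` — the
«`K` assez petit» step in the proof that a closed immersion of Shimura data induces injections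
`Sh_{K'}(G', X') → Sh_K(G, X)` at small level ([Deligne1971TravauxShimura] Prop. 1.15, pp. 132–133;
[Milne2005ShimuraVarieties] Thm. 5.16).  The statements and proofs here are the abstract compactness facts only.

## References
* N. Bourbaki, *General Topology*, Ch. I §9 no. 1 (finite intersection property) and Ch. III §4 no. 1, Prop. 1, Cor. 1
  (products of a compact and a closed set in a topological group) [BourbakiGT1].
* [Deligne1971TravauxShimura] P. Deligne, *Travaux de Shimura*, Sém. Bourbaki 389, LNM 244 (1971), Prop. 1.15 pp. 132–133.
* [Milne2005ShimuraVarieties] J. S. Milne, *Introduction to Shimura varieties* (2005; rev. 2017), Thm. 5.16.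
-/

set_option autoImplicit false

open scoped Pointwise
open Set

namespace Literature.Topology.Algebra

section Depth

variable {G : Type*} [Group G] [TopologicalSpace G] [IsTopologicalGroup G]

/-- **Compact-coset depth (core, pointwise form).**  Let `A, C ⊆ G` be compact subsets of a topological group and
`K : ι → Set G` (`ι` nonempty) a directed family of closed sets (`Directed (· ⊇ ·) K`).  If `x ∉ A * (⋂ i, K i) * C` then
`x ∉ A * K i * C` for some single index `i`.

Proof: the sets `tᵢ := {p ∈ G × G | p.1⁻¹ * x * p.2⁻¹ ∈ K i}` form a directed family of closed sets whose intersection does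
not meet the compact set `A ×ˢ C` (a common point `(a, c)` would give `a⁻¹ x c⁻¹ ∈ ⋂ Kᵢ`, i.e. `x = a k c ∈ A (⋂ Kᵢ) C`); by
compactness (`IsCompact.elim_directed_family_closed`) one single `tᵢ` misses `A ×ˢ C`, which says `x ∉ A Kᵢ C`.
[cite: BourbakiGT1, Ch. III §4 no. 1, Prop. 1 and Cor. 1] -/
theorem exists_not_mem_mul_mul_of_not_mem {ι : Type*} [Nonempty ι] {A C : Set G} (hA : IsCompact A)
    (hC : IsCompact C) (K : ι → Set G) (hKc : ∀ i, IsClosed (K i)) (hKd : Directed (· ⊇ ·) K)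
    {x : G} (hx : x ∉ A * (⋂ i, K i) * C) : ∃ i, x ∉ A * K i * C := by
  -- the continuous map `(a, c) ↦ a⁻¹ * x * c⁻¹`
  set f : G × G → G := fun p => p.1⁻¹ * x * p.2⁻¹
  have hfc : Continuous f := by
    have h1 : Continuous fun p : G × G => p.1⁻¹ := continuous_fst.inv
    have h2 : Continuous fun p : G × G => p.2⁻¹ := continuous_snd.inv
    exact (h1.mul continuous_const).mul h2
  -- the directed family of closed sets `tᵢ := f ⁻¹' Kᵢ`
  set t : ι → Set (G × G) := fun i => f ⁻¹' K i
  have htc : ∀ i, IsClosed (t i) := fun i => (hKc i).preimage hfc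
  have htd : Directed (· ⊇ ·) t := by
    intro i j
    obtain ⟨k, hki, hkj⟩ := hKd i j
    exact ⟨k, Set.preimage_mono hki, Set.preimage_mono hkj⟩
  -- its total intersection misses the compact set `A ×ˢ C`
  have hst : (A ×ˢ C) ∩ ⋂ i, t i = ∅ := by
    refine Set.eq_empty_iff_forall_notMem.mpr ?_
    rintro ⟨a, c⟩ ⟨⟨ha, hc⟩, hmem⟩
    have hk : a⁻¹ * x * c⁻¹ ∈ ⋂ i, K i := by
      refine Set.mem_iInter.mpr fun i => ?_
      have hi : (a, c) ∈ t i := Set.mem_iInter.mp hmem i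
      exact hi
    have hxac : x = a * (a⁻¹ * x * c⁻¹) * c := by
      rw [← mul_assoc, mul_inv_cancel_left, inv_mul_cancel_right]
    exact hx (hxac ▸ Set.mul_mem_mul (Set.mul_mem_mul ha hk) hc)
  obtain ⟨i, hi⟩ := (hA.prod hC).elim_directed_family_closed t htc hst htd
  refine ⟨i, fun hxi => ?_⟩
  -- `x ∈ A * K i * C` produces a point of `A ×ˢ C ∩ t i`
  obtain ⟨ak, hak, c, hc, rfl⟩ := Set.mem_mul.mp hxi
  obtain ⟨a, ha, k, hk, rfl⟩ := Set.mem_mul.mp hak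
  have hmem : (a, c) ∈ (A ×ˢ C) ∩ t i := by
    refine ⟨⟨ha, hc⟩, ?_⟩
    show (a, c).1⁻¹ * (a * k * c) * (a, c).2⁻¹ ∈ K i
    simpa [mul_assoc] using hk
  rw [hi] at hmem
  exact hmem

/-- **Compact-coset depth, intersection form: `⋂ i, A * K i * C = A * (⋂ i, K i) * C`** for compact `A, C ⊆ G` and a
nonempty directed family `(Kᵢ)` of closed sets (TWO-SIDED version of [BourbakiGT1] III §4.1 Cor. 1; the one-sided
`⋂ᵢ C * Uᵢ = C * ⋂ᵢ Uᵢ` for antitone families is `iInter_mul_eq_mul_iInter_of_isCompact` in `CompactMulInterAntitone`).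
The inclusion `⊇` is monotonicity of `*`, the inclusion `⊆` is `exists_not_mem_mul_mul_of_not_mem`.  No separation hypothesis
on `G` and no order on `ι`. [cite: BourbakiGT1, Ch. III §4 no. 1, Prop. 1 and Cor. 1] -/
theorem iInter_mul_mul_eq_mul_iInter_mul {ι : Type*} [Nonempty ι] {A C : Set G} (hA : IsCompact A)
    (hC : IsCompact C) (K : ι → Set G) (hKc : ∀ i, IsClosed (K i)) (hKd : Directed (· ⊇ ·) K) :
    ⋂ i, A * K i * C = A * (⋂ i, K i) * C := by
  refine Set.Subset.antisymm ?_ (Set.subset_iInter fun i => ?_)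
  · intro x hx
    by_contra hx'
    obtain ⟨i, hi⟩ := exists_not_mem_mul_mul_of_not_mem hA hC K hKc hKd hx'
    exact hi (Set.mem_iInter.mp hx i)
  · exact Set.mul_subset_mul_right (Set.mul_subset_mul_left (Set.iInter_subset _ i))

/-- One-sided mirror: **`⋂ i, K i * C = (⋂ i, K i) * C`** for compact `C` and a nonempty directed family `(Kᵢ)` of closed
sets (the case `A = {1}` of `iInter_mul_mul_eq_mul_iInter_mul`; the other one-sided form, compact factor on the left, is
`iInter_mul_eq_mul_iInter_of_isCompact`). [cite: BourbakiGT1, Ch. III §4 no. 1, Prop. 1 and Cor. 1] -/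
theorem iInter_mul_eq_iInter_mul {ι : Type*} [Nonempty ι] {C : Set G} (hC : IsCompact C) (K : ι → Set G)
    (hKc : ∀ i, IsClosed (K i)) (hKd : Directed (· ⊇ ·) K) : ⋂ i, K i * C = (⋂ i, K i) * C := by
  have h := iInter_mul_mul_eq_mul_iInter_mul isCompact_singleton hC K hKc hKd (A := {1})
  simpa only [Set.singleton_one, one_mul] using h

/-- **Compact-coset depth for shrinking levels, pointwise form.**  Let `A, C ⊆ G` be compact, `(Kᵢ)` a nonempty directed
family of closed sets with `⋂ i, K i ⊆ {1}`.  If `x ∉ A * C` then `x ∉ A * K i * C` for some `i`.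
[cite: Deligne1971TravauxShimura, proof of Prop. 1.15 pp. 132–133] -/
theorem exists_not_mem_mul_mul {ι : Type*} [Nonempty ι] {A C : Set G} (hA : IsCompact A) (hC : IsCompact C)
    (K : ι → Set G) (hKc : ∀ i, IsClosed (K i)) (hKd : Directed (· ⊇ ·) K) (hK : ⋂ i, K i ⊆ {1})
    {x : G} (hx : x ∉ A * C) : ∃ i, x ∉ A * K i * C := by
  refine exists_not_mem_mul_mul_of_not_mem hA hC K hKc hKd fun hx' => hx ?_
  have hsub : A * (⋂ i, K i) * C ⊆ A * {1} * C := Set.mul_subset_mul_right (Set.mul_subset_mul_left hK)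
  simpa only [Set.singleton_one, mul_one] using hsub hx'

/-- **Compact-coset depth for shrinking levels, finite form.**  Under the hypotheses of `exists_not_mem_mul_mul` (compact
`A, C`, a nonempty directed family of closed sets `Kᵢ` with `⋂ i, K i ⊆ {1}`), a FINITE set `E` with `E ∩ A * C = ∅`
satisfies `E ∩ A * K i * C = ∅` for one single index `i` (directedness lets one index serve all of `E`, since
`A * K j * C ⊆ A * K i * C` when `K j ⊆ K i`).  This is the form consumed by small-level injectivity arguments: finitely
many rational elements, one depth. [cite: Deligne1971TravauxShimura, proof of Prop. 1.15 pp. 132–133] -/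
theorem exists_forall_not_mem_mul_mul_of_finite {ι : Type*} [Nonempty ι] {A C : Set G} (hA : IsCompact A)
    (hC : IsCompact C) (K : ι → Set G) (hKc : ∀ i, IsClosed (K i)) (hKd : Directed (· ⊇ ·) K)
    (hK : ⋂ i, K i ⊆ {1}) {E : Set G} (hE : E.Finite) (hEAC : ∀ x ∈ E, x ∉ A * C) :
    ∃ i, ∀ x ∈ E, x ∉ A * K i * C := by
  induction E, hE using Set.Finite.induction_on with
  | empty => exact ⟨Classical.arbitrary ι, fun x hx => (Set.notMem_empty x hx).elim⟩
  | @insert x₀ s _ _ ih =>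
    obtain ⟨i, hi⟩ := ih fun x hx => hEAC x (Set.mem_insert_of_mem _ hx)
    obtain ⟨j, hj⟩ := exists_not_mem_mul_mul hA hC K hKc hKd hK (hEAC x₀ (Set.mem_insert _ _))
    obtain ⟨k, hki, hkj⟩ := hKd i j
    have hmono : ∀ {l m : ι}, K m ⊆ K l → A * K m * C ⊆ A * K l * C := fun h =>
      Set.mul_subset_mul_right (Set.mul_subset_mul_left h)
    refine ⟨k, fun x hx => ?_⟩
    rcases Set.mem_insert_iff.mp hx with rfl | hx
    · exact fun h => hj (hmono hkj h)
    · exact fun h => hi x hx (hmono hki h)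

/-- **Compact-coset depth for shrinking levels, intersection form: `⋂ i, A * K i * C = A * C`** for compact `A, C ⊆ G` and
a nonempty directed family `(Kᵢ)` of closed sets with `1 ∈ Kᵢ` for all `i` and `⋂ i, K i ⊆ {1}` (e.g. a neighbourhood
basis of `1` consisting of compact open subgroups).  [cite: BourbakiGT1, Ch. III §4 no. 1, Prop. 1 and Cor. 1]
[cite: Deligne1971TravauxShimura, proof of Prop. 1.15 pp. 132–133] -/
theorem iInter_mul_mul_eq {ι : Type*} [Nonempty ι] {A C : Set G} (hA : IsCompact A) (hC : IsCompact C)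
    (K : ι → Set G) (hKc : ∀ i, IsClosed (K i)) (hKd : Directed (· ⊇ ·) K) (hK1 : ∀ i, (1 : G) ∈ K i)
    (hK : ⋂ i, K i ⊆ {1}) : ⋂ i, A * K i * C = A * C := by
  have hone : ⋂ i, K i = {1} :=
    Set.Subset.antisymm hK (Set.singleton_subset_iff.mpr (Set.mem_iInter.mpr hK1))
  rw [iInter_mul_mul_eq_mul_iInter_mul hA hC K hKc hKd, hone, Set.singleton_one, mul_one]

end Depth

section Subgroups

variable {G : Type*} [Group G] [TopologicalSpace G] [IsTopologicalGroup G]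

/-- **Compact-coset depth for a directed family of closed subgroups, finite form.**  Let `K : ι → Subgroup G` (`ι`
nonempty) be directed for `≥` (any two members contain a common third), each `Kᵢ` closed, with trivial total intersection
(`∀ x, (∀ i, x ∈ K i) → x = 1`), and let `A, C ⊆ G` be compact.  Then every finite set `E` with `E ∩ A * C = ∅` misses
`A * Kᵢ * C` for one single index `i`.  (Typical instance: `Kᵢ` = principal congruence subgroups of an adelic group,
`A`, `C` compact cosets.) [cite: Deligne1971TravauxShimura, proof of Prop. 1.15 pp. 132–133] -/
theorem exists_forall_not_mem_mul_coe_mul_of_finite {ι : Type*} [Nonempty ι] {A C : Set G} (hA : IsCompact A)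
    (hC : IsCompact C) (K : ι → Subgroup G) (hKc : ∀ i, IsClosed (K i : Set G)) (hKd : Directed (· ≥ ·) K)
    (hK : ∀ x : G, (∀ i, x ∈ K i) → x = 1) {E : Set G} (hE : E.Finite) (hEAC : ∀ x ∈ E, x ∉ A * C) :
    ∃ i, ∀ x ∈ E, x ∉ A * (K i : Set G) * C := by
  refine exists_forall_not_mem_mul_mul_of_finite hA hC (fun i => (K i : Set G)) hKc ?_ ?_ hE hEAC
  · intro i j
    obtain ⟨k, hki, hkj⟩ := hKd i j
    exact ⟨k, SetLike.coe_subset_coe.mpr hki, SetLike.coe_subset_coe.mpr hkj⟩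
  · intro x hx
    exact Set.mem_singleton_iff.mpr (hK x fun i => Set.mem_iInter.mp hx i)

/-- **Compact-coset depth for a directed family of closed subgroups, intersection form.**  Let `K : ι → Subgroup G`
(`ι` nonempty) be directed for `≥`, each `Kᵢ` closed, with `∀ x, (∀ i, x ∈ K i) → x = 1`, and let `A, C ⊆ G` be compact.
Then `⋂ i, A * Kᵢ * C = A * C`. [cite: BourbakiGT1, Ch. III §4 no. 1, Prop. 1 and Cor. 1] -/
theorem iInter_mul_coe_mul_eq {ι : Type*} [Nonempty ι] {A C : Set G} (hA : IsCompact A) (hC : IsCompact C)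
    (K : ι → Subgroup G) (hKc : ∀ i, IsClosed (K i : Set G)) (hKd : Directed (· ≥ ·) K)
    (hK : ∀ x : G, (∀ i, x ∈ K i) → x = 1) : ⋂ i, A * (K i : Set G) * C = A * C := by
  refine iInter_mul_mul_eq hA hC (fun i => (K i : Set G)) hKc ?_ (fun i => (K i).one_mem) ?_
  · intro i j
    obtain ⟨k, hki, hkj⟩ := hKd i j
    exact ⟨k, SetLike.coe_subset_coe.mpr hki, SetLike.coe_subset_coe.mpr hkj⟩
  · intro x hx
    exact Set.mem_singleton_iff.mpr (hK x fun i => Set.mem_iInter.mp hx i)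

/-- **Compact-coset depth, «eventually» form for a decreasing family of closed subgroups.**  Let `ι` be a nonempty
upward-directed preorder and `K : ι → Subgroup G` ANTITONE (`i ≤ j → K j ≤ K i`), each `Kᵢ` closed, with
`∀ x, (∀ i, x ∈ K i) → x = 1`; let `A, C ⊆ G` be compact and `E` a finite set with `E ∩ A * C = ∅`.  Then there is a DEPTH
`i` such that `E ∩ A * Kⱼ * C = ∅` for EVERY `j ≥ i`.  (For a family that decreases along a downward-directed index — e.g.
congruence subgroups `K(𝔫)` indexed by ideals `𝔫` under inclusion — apply this to `ιᵒᵈ`, or use the `Directed` form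
`exists_forall_not_mem_mul_coe_mul_of_finite` directly.) [cite: Deligne1971TravauxShimura, proof of Prop. 1.15 pp. 132–133] -/
theorem exists_forall_ge_forall_not_mem_mul_coe_mul_of_finite {ι : Type*} [Preorder ι] [Nonempty ι]
    [IsDirectedOrder ι] {A C : Set G} (hA : IsCompact A) (hC : IsCompact C) (K : ι → Subgroup G)
    (hKc : ∀ i, IsClosed (K i : Set G)) (hKa : Antitone K) (hK : ∀ x : G, (∀ i, x ∈ K i) → x = 1) {E : Set G}
    (hE : E.Finite) (hEAC : ∀ x ∈ E, x ∉ A * C) :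
    ∃ i, ∀ j, i ≤ j → ∀ x ∈ E, x ∉ A * (K j : Set G) * C := by
  obtain ⟨i, hi⟩ := exists_forall_not_mem_mul_coe_mul_of_finite hA hC K hKc
    (directed_of_isDirected_le fun _ _ hij => hKa hij) hK hE hEAC
  refine ⟨i, fun j hij x hx h => hi x hx ?_⟩
  exact Set.mul_subset_mul_right (Set.mul_subset_mul_left (SetLike.coe_subset_coe.mpr (hKa hij))) h

end Subgroups

end Literature.Topology.Algebra
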